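import Summits.BirchSwinnertonDyer.BirchSwinnertonDyer.Theorems.Rank2ObservatoryCubicFieldR329972
import HarnessLib

/-!
# BirchSwinnertonDyer — rank ≥ 2 observatory: class number one of the cubic field of `-33 + 155 * X - 25 * X ^ 2 + X ^ 3` (`Δ = 329972`) — certificates at the primes 149, 151, 157

HONEST FRAMING: per-curve certified theorems and census instruments; no claim on BSD in rank ≥ 2.

Companion of the per-FIELD file `Rank2ObservatoryCubicFieldR329972` of the KERNEL-2DESC instrument (design
`b2b-bsdr2-cert-3/KERNEL-2DESC.md` §9e–§9g): the degree-one prime-element certificates at the primes 149, 151, 157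
(part b). Split off for file size; generated by the same generator from the same checked data.
Sorry-free; axioms `propext`, `Classical.choice`, `Quot.sound`.
[cite: Marcus2018, Ch. 3 Thm. 27, Ch. 5 Cor. 2 of Thm. 37]
-/

-- single-conjunct summit: `Summit.BirchSwinnertonDyer.BirchSwinnertonDyer.…` repeats the name by design
set_option linter.dupNamespace false

noncomputable section

open scoped Classical NumberField

open Literature.NumberTheory.NumberFields Polynomial Module NumberField

namespace Summit.BirchSwinnertonDyer.BirchSwinnertonDyer.Rank2Observatory.TwoDescCubic

namespace FieldR329972

/-! ## Class number one -/

/-- Certificate at `149`: `g` has no root mod `149`, so there is no ring map `𝓞 K → ℤ/149`. [folklore] -/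
theorem cert149 (ψ : 𝓞 (CubicField (-25) 155 (-33)) →+* ZMod 149) : ∃ e : 𝓞 (CubicField (-25) 155 (-33)), ψ e = 0 ∧ Prime e :=
  cert_of_no_root aeval_α ψ (by decide +kernel)

/-- Certificate at `151`: `g` has no root mod `151`, so there is no ring map `𝓞 K → ℤ/151`. [folklore] -/
theorem cert151 (ψ : 𝓞 (CubicField (-25) 155 (-33)) →+* ZMod 151) : ∃ e : 𝓞 (CubicField (-25) 155 (-33)), ψ e = 0 ∧ Prime e :=
  cert_of_no_root aeval_α ψ (by decide +kernel)

/-- Certificate at `157`: `g` has no root mod `157`, so there is no ring map `𝓞 K → ℤ/157`. [folklore] -/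
theorem cert157 (ψ : 𝓞 (CubicField (-25) 155 (-33)) →+* ZMod 157) : ∃ e : 𝓞 (CubicField (-25) 155 (-33)), ψ e = 0 ∧ Prime e :=
  cert_of_no_root aeval_α ψ (by decide +kernel)

end FieldR329972

end Summit.BirchSwinnertonDyer.BirchSwinnertonDyer.Rank2Observatory.TwoDescCubic

end
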